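import Mathlib
import Summits.ValiantsHypothesis.ValiantsHypothesis.Theorems.FeketeSOSCharPSparseSOSStubWindowCounting
import Summits.ValiantsHypothesis.ValiantsHypothesis.Theorems.FeketeSOSCharPSparseSOSStubCharSum211
import Summits.ValiantsHypothesis.ValiantsHypothesis.Theorems.FeketeSOSCharPSparseSOSStubFourthMomentExpand
import Summits.ValiantsHypothesis.ValiantsHypothesis.Theorems.FeketeSOSCharPSparseSOSStubDegenerateQuadruples
import Summits.ValiantsHypothesis.ValiantsHypothesis.Theorems.FeketeSOSCharPSparseSOSStubFirstLemmaAssembly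

/-!
# Crux `FeketeSOS.CharPSparseSOS` (stmt-ValiantsHypothesis-14989), line `Sketch-ideator5` —
# the First Lemma of card `frobenius-trace-bias` and the two-colour Paley biclique shadow of K1

Notation: `p` an odd prime, `χ = χ_p = legendreSym p`, `Q ⊆ [0,p)` a finite set of naturals,
`Λ_Q(x) = Σ_{a∈Q} χ(x+a)`, `S_p(a,b,c,d) = Σ_{x<p} χ((x+a)(x+b)(x+c)(x+d))` (for pairwise distinct
entries `= −1 − a_p` of the genus-one curve `y² = (x+a)(x+b)(x+c)(x+d)`), `r_Q(n)` the restricted pair-sum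
count and `Err = {n < p : r_Q(n) ≠ 1_QR(n)}` exactly as in `rQ_far_from_QR_of_charPSparseSOS` (p112874).

`K1(η)` ("TraceBias") is the statement: for all large `p` and all `Q` with `#Q ≥ (1−η)√p`,
`Σ_{distinct (a,b,c,d) ∈ Q⁴} S_p(a,b,c,d) ≤ (1−η)√p·#Q⁴`.  It is OPEN; this file takes it as an explicit
hypothesis and records two kernel-checked consequences:

* `fourthMoment_le` — `Σ_{x<p} Λ_Q(x)⁴ ≤ Σ_{distinct} S_p + 16 p #Q²` (stubs `stub_fourthMomentExpand`,
  `stub_charSum211`, `stub_degenerateQuadruples` glued).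
* `robustShkredovWindow_of_traceBias` — **First Lemma**: `K1(η)` implies, for every window exponent
  `0 < δ < 1/2` and all large `p`, that every `Q` with `#Q ≤ √p + p^δ` satisfies p112874's conclusion
  `p^{1/2+δ} ≤ 3#Q + 2#Err + 13√p + 13` (with `stub_windowCounting` and `stub_firstLemmaAssembly`).
  So the far side of the crux-level barrier, IN THE WINDOW, reduces to the quartic large-deviation
  statement K1.
* `monochromatic_translates_bound_of_traceBias` — the exact shadow of K1: `K1(η)` implies that a set
  `Q ⊆ 𝔽_p` with `#Q ≥ (1−η)√p` has at most `(1−η)√p + 16 p/#Q²` translates `x + Q` lying entirely in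
  the non-zero squares or entirely in the non-squares (two-colour Paley bicliques `X × Q`).  Completion
  (`Σ_x Λ_Q² = p#Q − #Q²`) gives only `p/#Q − 1 ≈ √p/(1−η)`, and the Hanson–Petridis polynomial method
  gives `≈ √p/2 + 1` per colour, i.e. `√p + 2` for both colours together: K1 is a constant-factor
  improvement of completion for two-colour Paley bicliques at the self-dual size — not in print.
-/

-- `Summit.ValiantsHypothesis.ValiantsHypothesis.…` is the tree's mandated single-conjunct layout (Sub = Summit).
set_option linter.dupNamespace false

namespace Summit.ValiantsHypothesis.ValiantsHypothesis.Theorems.CharPSparseSOSTraceBias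

open Finset

/-! ## The fourth-moment bound -/

/-- The `{u,u,v,w}` four-point sums are `≤ 0`: by `stub_charSum211` they equal `−1 − χ((v−u)(w−u)) ≤ 0`. -/
theorem charSum211_nonpos (p : ℕ) [Fact p.Prime] (hp : p ≠ 2) (u v w : ℕ) (hu : u < p) (hv : v < p)
    (hw : w < p) (huv : u ≠ v) (huw : u ≠ w) (hvw : v ≠ w) :
    (∑ x ∈ range p, legendreSym p (((x : ℤ) + u) * ((x : ℤ) + u) * ((x : ℤ) + v) * ((x : ℤ) + w))) ≤ 0 := by
  rw [stub_charSum211 p hp u v w hu hv hw huv huw hvw]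
  have := wc_neg_one_le_legendreSym p (((v : ℤ) - u) * ((w : ℤ) - u))
  linarith

/-- **Fourth-moment bound.**  `Σ_{x<p} Λ_Q(x)⁴ ≤ Σ_{distinct (a,b,c,d)∈Q⁴} S_p(a,b,c,d) + 16 p #Q²`:
expand the fourth power (`stub_fourthMomentExpand`), split the quadruples into pairwise-distinct and
degenerate ones, and bound the degenerate ones by `stub_degenerateQuadruples` (the `{u,u,v,w}` sums being
`≤ 0` by `charSum211_nonpos`). -/
theorem fourthMoment_le (p : ℕ) [Fact p.Prime] (hp : p ≠ 2) (Q : Finset ℕ) (hQ : ∀ a ∈ Q, a < p) :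
    (∑ x ∈ range p, (∑ a ∈ Q, legendreSym p ((x : ℤ) + a)) ^ 4) ≤
      (∑ t ∈ ((Q ×ˢ Q) ×ˢ (Q ×ˢ Q)).filter (fun t : (ℕ × ℕ) × (ℕ × ℕ) =>
          t.1.1 ≠ t.1.2 ∧ t.1.1 ≠ t.2.1 ∧ t.1.1 ≠ t.2.2 ∧ t.1.2 ≠ t.2.1 ∧ t.1.2 ≠ t.2.2 ∧ t.2.1 ≠ t.2.2),
        ∑ x ∈ range p, legendreSym p
          (((x : ℤ) + t.1.1) * ((x : ℤ) + t.1.2) * ((x : ℤ) + t.2.1) * ((x : ℤ) + t.2.2))) +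
      16 * (p : ℤ) * (Q.card : ℤ) ^ 2 := by
  rw [stub_fourthMomentExpand p Q]
  have h211 : ∀ u ∈ Q, ∀ v ∈ Q, ∀ w ∈ Q, u ≠ v → u ≠ w → v ≠ w →
      (∑ x ∈ range p, legendreSym p
        (((x : ℤ) + u) * ((x : ℤ) + u) * ((x : ℤ) + v) * ((x : ℤ) + w))) ≤ 0 :=
    fun u hu v hv w hw huv huw hvw => charSum211_nonpos p hp u v w (hQ u hu) (hQ v hv) (hQ w hw) huv huw hvw
  have hdeg := stub_degenerateQuadruples p Q hQ h211
  rw [← sum_filter_add_sum_filter_not ((Q ×ˢ Q) ×ˢ (Q ×ˢ Q)) (fun t : (ℕ × ℕ) × (ℕ × ℕ) =>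
      t.1.1 ≠ t.1.2 ∧ t.1.1 ≠ t.2.1 ∧ t.1.1 ≠ t.2.2 ∧ t.1.2 ≠ t.2.1 ∧ t.1.2 ≠ t.2.2 ∧ t.2.1 ≠ t.2.2)]
  linarith

/-! ## The First Lemma: K1 ⇒ robust Shkredov in the window -/

/-- **First Lemma of the line** (card `frobenius-trace-bias`, `FirstLemma : TraceBias → RobustShkredovWindow`).
If `K1(η)` holds for some `η ∈ (0,1)` — for all large primes `p` and every `Q ⊆ [0,p)` with
`#Q ≥ (1−η)√p`, `Σ_{distinct} S_p ≤ (1−η)√p·#Q⁴` — then for every window exponent `0 < δ < 1/2` and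
all large primes `p`, every `Q ⊆ [0,p)` with `#Q ≤ √p + p^δ` satisfies the conclusion of
`rQ_far_from_QR_of_charPSparseSOS` (p112874): `p^{1/2+δ} ≤ 3#Q + 2#{n < p : r_Q(n) ≠ 1_QR(n)} + 13√p + 13`.
(Near-perfection gives coverage and `Σ_{x∈Q}Λ_Q ≈ p`; the power mean on `Q` and the fourth-moment bound
turn this into `Σ_{distinct} S_p ≥ (1−o(1))√p·#Q⁴`, contradicting K1.) -/
theorem robustShkredovWindow_of_traceBias :
    ∀ η : ℝ, 0 < η → η < 1 →
      (∃ p₀ : ℕ, ∀ (p : ℕ) [Fact p.Prime], p₀ ≤ p → ∀ Q : Finset ℕ, (∀ a ∈ Q, a < p) →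
        (1 - η) * Real.sqrt p ≤ (Q.card : ℝ) →
        (∑ t ∈ ((Q ×ˢ Q) ×ˢ (Q ×ˢ Q)).filter (fun t : (ℕ × ℕ) × (ℕ × ℕ) =>
            t.1.1 ≠ t.1.2 ∧ t.1.1 ≠ t.2.1 ∧ t.1.1 ≠ t.2.2 ∧ t.1.2 ≠ t.2.1 ∧ t.1.2 ≠ t.2.2 ∧ t.2.1 ≠ t.2.2),
          ((∑ x ∈ range p, legendreSym p
            (((x : ℤ) + t.1.1) * ((x : ℤ) + t.1.2) * ((x : ℤ) + t.2.1) * ((x : ℤ) + t.2.2)) : ℤ) : ℝ)) ≤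
        (1 - η) * Real.sqrt p * (Q.card : ℝ) ^ 4) →
      ∀ δ : ℝ, 0 < δ → δ < 1 / 2 →
      ∃ p₁ : ℕ, ∀ (p : ℕ) [Fact p.Prime], p₁ ≤ p → ∀ Q : Finset ℕ, (∀ a ∈ Q, a < p) →
        (Q.card : ℝ) ≤ Real.sqrt p + (p : ℝ) ^ δ →
        (p : ℝ) ^ (1 / 2 + δ) ≤ 3 * (Q.card : ℝ) +
          2 * (((range p).filter (fun n => ((Q ×ˢ Q).filter
              (fun ab : ℕ × ℕ => ab.1 < ab.2 ∧ (ab.1 + ab.2) % p = n)).card ≠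
                (if n ≠ 0 ∧ legendreSym p n = 1 then 1 else 0))).card : ℝ) +
          13 * Real.sqrt p + 13 := by
  intro η hη hη1 hK1 δ hδ hδ2
  exact stub_firstLemmaAssembly η δ hη hη1 hδ hδ2 hK1 stub_windowCounting
    (fun p _ hp Q hQ => fourthMoment_le p hp Q hQ)

/-! ## The exact shadow of K1: two-colour Paley bicliques -/

/-- A monochromatic translate contributes `#Q⁴` to the fourth moment: if `χ(x+a) = 1` for all `a ∈ Q`, or
`χ(x+a) = −1` for all `a ∈ Q`, then `Λ_Q(x)⁴ = #Q⁴`. -/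
theorem lambda_pow_four_of_monochromatic (p : ℕ) [Fact p.Prime] (Q : Finset ℕ) (x : ℕ)
    (hx : (∀ a ∈ Q, legendreSym p ((x : ℤ) + a) = 1) ∨ (∀ a ∈ Q, legendreSym p ((x : ℤ) + a) = -1)) :
    (∑ a ∈ Q, legendreSym p ((x : ℤ) + a)) ^ 4 = (Q.card : ℤ) ^ 4 := by
  rcases hx with h | h
  · rw [sum_congr rfl (fun a ha => h a ha), sum_const, nsmul_eq_mul, mul_one]
  · rw [sum_congr rfl (fun a ha => h a ha), sum_const, nsmul_eq_mul, mul_neg, mul_one]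
    ring

/-- **Monochromatic translates are counted by the fourth moment**:
`#{x < p : x + Q ⊆ QR or x + Q ⊆ NQR} · #Q⁴ ≤ Σ_{x<p} Λ_Q(x)⁴`. -/
theorem card_monochromatic_mul_le_fourthMoment (p : ℕ) [Fact p.Prime] (Q : Finset ℕ) :
    ((((range p).filter (fun x : ℕ => (∀ a ∈ Q, legendreSym p ((x : ℤ) + a) = 1) ∨
        (∀ a ∈ Q, legendreSym p ((x : ℤ) + a) = -1))).card : ℤ) * (Q.card : ℤ) ^ 4) ≤
      ∑ x ∈ range p, (∑ a ∈ Q, legendreSym p ((x : ℤ) + a)) ^ 4 := by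
  classical
  set W := (range p).filter (fun x : ℕ => (∀ a ∈ Q, legendreSym p ((x : ℤ) + a) = 1) ∨
        (∀ a ∈ Q, legendreSym p ((x : ℤ) + a) = -1)) with hW
  have h1 : ((W.card : ℤ) * (Q.card : ℤ) ^ 4) = ∑ x ∈ W, (∑ a ∈ Q, legendreSym p ((x : ℤ) + a)) ^ 4 := by
    rw [sum_congr rfl (fun x hx => lambda_pow_four_of_monochromatic p Q x (mem_filter.mp hx).2),
      sum_const, nsmul_eq_mul]
  rw [h1]
  refine sum_le_sum_of_subset_of_nonneg (filter_subset _ _) (fun x _ _ => ?_)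
  have : (∑ a ∈ Q, legendreSym p ((x : ℤ) + a)) ^ 4 = ((∑ a ∈ Q, legendreSym p ((x : ℤ) + a)) ^ 2) ^ 2 := by
    ring
  rw [this]; positivity

/-- **Two-colour Paley biclique shadow of K1.**  Assume `K1(η)` beyond `p₀`.  Then for every prime
`p ≥ p₀`, `p ≠ 2`, and every `Q ⊆ [0,p)` with `#Q ≥ (1−η)√p`, the number `w` of translates `x < p`
with `x + Q` entirely inside the non-zero quadratic residues or entirely inside the non-residues satisfies
`w·#Q⁴ ≤ (1−η)√p·#Q⁴ + 16 p #Q²`, i.e. `w ≤ (1−η)√p + 16p/#Q² ≤ (1−η)√p + 16(1−η)⁻²`.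
For comparison: completion (`Σ_x Λ_Q(x)² = p#Q − #Q²`) gives only `w ≤ p/#Q − 1 ≤ √p/(1−η) − 1`, and the
Hanson–Petridis bound `|A||B| ≤ (p−1)/2 + |B ∩ (−A)|` for `A + B ⊆ QR ∪ {0}` gives `≈ √p/2 + 1` for
EACH colour, `√p + 2` for both: so K1 is (at least) a constant-factor improvement of completion for
two-colour Paley bicliques `X × Q` at the self-dual size `#X ≈ #Q ≈ √p`, which is not in print. -/
theorem monochromatic_translates_bound_of_traceBias :
    ∀ (η : ℝ) (p₀ : ℕ), (∀ (p : ℕ) [Fact p.Prime], p₀ ≤ p → ∀ Q : Finset ℕ, (∀ a ∈ Q, a < p) →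
        (1 - η) * Real.sqrt p ≤ (Q.card : ℝ) →
        (∑ t ∈ ((Q ×ˢ Q) ×ˢ (Q ×ˢ Q)).filter (fun t : (ℕ × ℕ) × (ℕ × ℕ) =>
            t.1.1 ≠ t.1.2 ∧ t.1.1 ≠ t.2.1 ∧ t.1.1 ≠ t.2.2 ∧ t.1.2 ≠ t.2.1 ∧ t.1.2 ≠ t.2.2 ∧ t.2.1 ≠ t.2.2),
          ((∑ x ∈ range p, legendreSym p
            (((x : ℤ) + t.1.1) * ((x : ℤ) + t.1.2) * ((x : ℤ) + t.2.1) * ((x : ℤ) + t.2.2)) : ℤ) : ℝ)) ≤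
        (1 - η) * Real.sqrt p * (Q.card : ℝ) ^ 4) →
      ∀ (p : ℕ) [Fact p.Prime], p₀ ≤ p → p ≠ 2 → ∀ Q : Finset ℕ, (∀ a ∈ Q, a < p) →
        (1 - η) * Real.sqrt p ≤ (Q.card : ℝ) →
        (((range p).filter (fun x : ℕ => (∀ a ∈ Q, legendreSym p ((x : ℤ) + a) = 1) ∨
            (∀ a ∈ Q, legendreSym p ((x : ℤ) + a) = -1))).card : ℝ) * (Q.card : ℝ) ^ 4 ≤
          (1 - η) * Real.sqrt p * (Q.card : ℝ) ^ 4 + 16 * (p : ℝ) * (Q.card : ℝ) ^ 2 := by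
  intro η p₀ hK1 p _ hp₀ hp2 Q hQ hq
  have h1 := card_monochromatic_mul_le_fourthMoment p Q
  have h2 := fourthMoment_le p hp2 Q hQ
  have h3 := hK1 p hp₀ Q hQ hq
  have h12 : ((((range p).filter (fun x : ℕ => (∀ a ∈ Q, legendreSym p ((x : ℤ) + a) = 1) ∨
        (∀ a ∈ Q, legendreSym p ((x : ℤ) + a) = -1))).card : ℤ) * (Q.card : ℤ) ^ 4) ≤
      (∑ t ∈ ((Q ×ˢ Q) ×ˢ (Q ×ˢ Q)).filter (fun t : (ℕ × ℕ) × (ℕ × ℕ) =>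
          t.1.1 ≠ t.1.2 ∧ t.1.1 ≠ t.2.1 ∧ t.1.1 ≠ t.2.2 ∧ t.1.2 ≠ t.2.1 ∧ t.1.2 ≠ t.2.2 ∧ t.2.1 ≠ t.2.2),
        ∑ x ∈ range p, legendreSym p
          (((x : ℤ) + t.1.1) * ((x : ℤ) + t.1.2) * ((x : ℤ) + t.2.1) * ((x : ℤ) + t.2.2))) +
      16 * (p : ℤ) * (Q.card : ℤ) ^ 2 := h1.trans h2
  have h12r := (Int.cast_le (R := ℝ)).mpr h12
  push_cast at h12r h3
  linarith

end Summit.ValiantsHypothesis.ValiantsHypothesis.Theorems.CharPSparseSOSTraceBias
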